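import Literature.NumberTheory.EllipticCurves.Kato2004.IwasawaH1LayerTorsionBoundProofs
import Literature.NumberTheory.EllipticCurves.Kato2004.IwasawaH1TorsionFreeProofs
import HarnessLib

/-!
# An element of Kato's `𝐇¹_Γ(T_pW)` all of whose layer components are torsion classes is zero

Topic `NumberTheory/EllipticCurves`, sub-directory `Kato2004` (namespace = path).  THEOREMS ONLY.
Cell `bsd-potss` (seat `bsd-potss-rkm` g7, item stmt-BirchSwinnertonDyer-19196; Kato-infrastructure on
the pin `Kato2004.IwasawaH1Data`).  Combining the UNIFORM torsion bound along the tower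
(`IwasawaH1LayerNorm.exists_forall_pow_smul_eq_zero_of_pow_smul_eq_zero`: one `p^c` kills the torsion of
every `H¹(ℚ_n, T_pW)`) with "`𝐇¹_Γ` has no `p`-torsion"
(`IwasawaH1Data.eq_zero_of_prime_pow_nsmul_eq_zero`, Kato Thm. 12.4 (2), `p`-part): a norm-compatible
integral family `x = (x_n)_n` with every `x_n` a TORSION class is `0` — i.e. `𝐇¹_Γ(T_pW)` embeds into
`∏_n H¹(ℚ_n, T_pW)/tors ⊂ ∏_n H¹(ℚ_n, V_pW)`, the form in which `Λ`-adic classes (zeta elements) are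
compared through their images in characteristic-zero cohomology.  No hypothesis on `γ`.

* **`IwasawaH1Data.eq_zero_of_forall_proj_isTorsion`** — `(∀ n, ∃ k, p^k • proj n x = 0) → x = 0`.
* `IwasawaH1Data.eq_of_forall_proj_sub_isTorsion` — two elements whose components agree modulo torsion
  at every layer are equal.

## References

* [Kato2004Asterisque] K. Kato, Astérisque 295 (2004), Thm. 12.4 (2) (p. 221), §13.8 (p. 228).
* [GreenbergLNM1716] R. Greenberg, LNM 1716 (1999), §1 p. 62, §3 p. 86.
* [Rubin2000] K. Rubin, *Euler Systems* (2000), App. B §2–§3.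
-/

noncomputable section

open scoped NumberField
open Field CategoryTheory
open Literature.NumberTheory.GaloisRepresentations
open Literature.NumberTheory.EllipticCurves Literature.NumberTheory.EllipticCurves.Kato2004
open Literature.NumberTheory.EllipticCurves.Kato2004.EulerSystemValues

namespace Literature.NumberTheory.EllipticCurves.Kato2004

variable {p : ℕ} [Fact p.Prime] {W : WeierstrassCurve ℚ} [W.IsElliptic]
  [ContinuousSMul ℤ_[p] (W.tateModule p)] {κ : ZpExtension ℚ p} {γ : absoluteGaloisGroup ℚ}

/-- **An element of `𝐇¹_Γ(T_pW)` with torsion components at every layer is zero.**  For every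
elliptic curve `E/ℚ`, prime `p`, `ℤ_p`-extension `κ`, any `γ` and any datum `I : IwasawaH1Data W p κ γ`:
if for every `n` some power of `p` kills `proj n x ∈ H¹(ℚ_n, T_pW)`, then `x = 0` (the torsion of
`H¹(ℚ_n, T_pW)` is killed by a power `p^c` independent of `n`, so `p^c • x = 0`, and `𝐇¹_Γ` has no
`p`-torsion). [cite: Kato2004Asterisque, Thm. 12.4 (2) (p. 221) and §13.8 (p. 228)]
[cite: GreenbergLNM1716, §1 p. 62 and §3 p. 86] -/
theorem IwasawaH1Data.eq_zero_of_forall_proj_isTorsion (I : IwasawaH1Data W p κ γ) (x : I.H)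
    (hx : ∀ n : ℕ, ∃ k : ℕ, ((p : ℤ_[p]) ^ k) • I.proj n x = 0) : x = 0 := by
  obtain ⟨c, hc⟩ := IwasawaH1LayerNorm.exists_forall_pow_smul_eq_zero_of_pow_smul_eq_zero (p := p) W κ
  refine I.eq_zero_of_prime_pow_nsmul_eq_zero c x (I.proj_injective _ fun n => ?_)
  obtain ⟨k, hk⟩ := hx n
  have h := hc n k (I.proj n x) hk
  rwa [← Nat.cast_pow, Nat.cast_smul_eq_nsmul, ← map_nsmul] at h

/-- **Two elements of `𝐇¹_Γ(T_pW)` whose components agree modulo torsion at every layer are equal**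
(`𝐇¹_Γ ↪ ∏_n H¹(ℚ_n, T_pW)/tors`). [cite: Kato2004Asterisque, Thm. 12.4 (2) (p. 221) and §13.8 (p. 228)] -/
theorem IwasawaH1Data.eq_of_forall_proj_sub_isTorsion (I : IwasawaH1Data W p κ γ) (x y : I.H)
    (hxy : ∀ n : ℕ, ∃ k : ℕ, ((p : ℤ_[p]) ^ k) • (I.proj n x - I.proj n y) = 0) : x = y := by
  rw [← sub_eq_zero]
  exact I.eq_zero_of_forall_proj_isTorsion (x - y) fun n => by
    obtain ⟨k, hk⟩ := hxy n
    exact ⟨k, by rwa [map_sub]⟩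

end Literature.NumberTheory.EllipticCurves.Kato2004

end
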